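import Mathlib
import HarnessLib
import Summits.HubbardSuperconductivity.HubbardSuperconductivity.Theorems.KLProgrammeKLRegimeEngineTowerBlockStepWtOriented
import Summits.HubbardSuperconductivity.HubbardSuperconductivity.Theorems.KLProgrammeKLRegimeEngineTowerDoorToKitOriented
import Summits.HubbardSuperconductivity.HubbardSuperconductivity.Theorems.KLProgrammeKLRegimeEngineTowerBlockIncrLevKit

/-!
# LINK-F (i)–(iii), GENERIC IN THE DOOR FORM — the oriented kit form for ANY oriented door-form bound (any keying of the input rows)
# (crux K3 ENGINE, stmt-HubbardSuperconductivity-20437 `KLRegimeEngineV17F2`, stub (b) v2, levels package (ℓ), located items #10 / #16;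
#  cell gate-hubbard-kl, seat hubbard-kl-k3c3-p2 g15 — E1 / the LINK-F lane may rename or supersede)

`…TowerBlockIncrLevOrientedKit.klLevNormOf_klTowerIncr_le_kit_oriented9` (p679779) composed the output bridge, the oriented kit majorisation and the
first-order majorisation on ONE door-form instance (`doorSum_klTowerIncr_le_oriented9`, input rows keyed on the pin-UNcredited bridges).  Located item #16
«(ℓ)-LEV-INST-PINCREDIT» (k3c2-p3 g14) re-keys the door instance on the pin-CREDITED rows and discharges (I3) with concrete floor arrays
(`…TowerBlockIncrLevOrientedF`).  So that EVERY such instance reaches the kit form by one `exact`, this file performs the composition with the DOOR FORM AS A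
HYPOTHESIS: any output element `T′`, any input family index `n₁ ≤ J′`, any line constants `α ≤ α_g` (tail / graded), any full-pin array `B` (entering
only the flat tail `normV (ε·B m′ 0)` and the first order `27^{|J|}·ε·B m′ |J|`), any graded sizes `Bm ≥ 0` with `Bm 0 = 0` and floor ratio `0 ≤ θ ≤ 1`:

* §1 `doorBinomialPrescribedJ_le_towerFO_at` — the first-order majorisation with the track-blind majorant needed ONLY at the level `|J|` that occurs
  (so the first order keeps the floor credit of its level: `NF` may be level-aware);
* §2 **`klLevNormOf_le_kit_oriented_of_doorForm`** — for every prescription `Ωe` of level `F`: if the door form holds at every `(p, J ∌ p, τ″, w″)`, then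
  `klLevNormOf … J′ (2(q+1)) T′ Ωe ≤ ε^{2q+1}·(cr·cc^{2q+1}·(27^F·(θ^{lumps F}·S + T)) + cr·cc^{2q+1}·((e²)^{q+2}/2·towerFO D κ² NF (q+1)))`,
  `S = Σ_{n∈[2,N₀−1]} e·Φ^{n−1}·ψ^{q+1}·towerS D τ Bm n (q+1)`, `T = ψ^{q+1}·e·V·(ΦV)^{N₀−1}/(1−ΦV)`, `Φ = e·α_g/κ²`, `V = towerV D τ Nt`, under
  `ε·B m 0 ≤ Nt m` (tail, track-blind, `Nt 0 = 0`), `27^c·ε·B m c ≤ NF m` for `c + 1 ≥ F` (first order, level-aware), the kit parameters and the kit guard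
  `Φ·V < 1` (per `p`: `J_p = {i ≠ p : Ωe i prescribed}`, `|J_p| ∈ {F−1, F}`; parents `≤ 27^F` by `card_parentsLeg_klAniso_le`; `θ^{lumps(1+|J_p|)} ≤ θ^{lumps F}`).
Pure composition; nothing about the model is asserted; nothing asserts (ℓ), any stub, K3 or superconductivity.
References: BGM 2006 §2.7 (2.71a), §2.8 (2.76)–(2.84), (2.88)–(2.90), (2.97)–(2.98), §3 (3.2)–(3.8), App. A4 [cite: BenfattoGiulianiMastropietro2006].
-/

noncomputable section

namespace Summit.HubbardSuperconductivity.HubbardSuperconductivity.Theorems.EngineV8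

set_option linter.dupNamespace false -- summit = problem name (single-conjunct summit), D-0017

open Classical
open Real Finset Literature.MathematicalPhysics.QuantumLattice Literature.Probability.LatticeModels GrassmannAlgebra
open Literature.MathematicalPhysics.QuantumLattice.FermiRG Literature.MathematicalPhysics.QuantumLattice.FermiRG.BGM2006Routing
open Summit.HubbardSuperconductivity.HubbardSuperconductivity.Theorems.KLProgrammeLegKernels
open Summit.HubbardSuperconductivity.HubbardSuperconductivity.Theorems.KLRegimeSplit
open Summit.HubbardSuperconductivity.HubbardSuperconductivity.Theorems.KLRegimeWick
open Summit.HubbardSuperconductivity.HubbardSuperconductivity.Theorems.TwoPointAssembly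
open Summit.HubbardSuperconductivity.HubbardSuperconductivity.Theorems.DispersionFlow
open scoped Nat

/-! ## §1 First order: the majorant is needed only at the level that occurs -/

/-- **THE BINOMIAL-PRESCRIBED `J`-FORM UNDER `towerFO`, MAJORANT AT LEVEL `|J|` ONLY** (`σ := κ²`): as `doorBinomialPrescribedJ_le_towerFO`, but the
track-blind majorant `N` is asked only at the level `|J|` of the prescribed leg set: `ρc^{|J|}·ε·B m′ |J| ≤ N m′`. -/
theorem doorBinomialPrescribedJ_le_towerFO_at {κ ρc ε : ℝ} (hκ : 0 ≤ κ) (hρc : 0 ≤ ρc) (hε : 0 ≤ ε)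
    {B : ℕ → ℕ → ℝ} (hB0 : ∀ m c, 0 ≤ B m c) {q : ℕ} (J : Finset (Fin (2 * (q + 1)))) {N : ℕ → ℝ}
    (hNB : ∀ m, ρc ^ J.card * (ε * B m J.card) ≤ N m) {DΓ D : ℕ} (hD : DΓ ≤ D) :
    ∑ m' ∈ range (DΓ + 1), (if q + 1 < m' then
        ((((2 * (q + 1)) ! : ℝ))⁻¹ * ((∏ j ∈ univ.filter (fun j : Fin (2 * (q + 1)) => j ∉ J), (2 * m' - (j : ℕ)) : ℕ) : ℝ)) *
          ((2 * m' : ℕ) : ℝ) ^ J.card * κ ^ (2 * m' - 2 * (q + 1)) * (ρc ^ J.card * (ε * B m' J.card)) else 0) ≤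
      exp 2 ^ (q + 2) / 2 * towerFO D (κ ^ 2) N (q + 1) := by
  rw [towerFO, ← sum_filter, mul_sum]
  have hsub : (range (DΓ + 1)).filter (fun m' => q + 1 < m') ⊆ Ioc (q + 1) D := by
    intro m' hm'
    rw [mem_filter, mem_range] at hm'
    rw [mem_Ioc]
    exact ⟨hm'.2, by omega⟩
  refine (sum_le_sum_of_subset_of_nonneg hsub fun m' _ _ => ?_).trans (sum_le_sum fun m' hm' => ?_)
  · exact mul_nonneg (mul_nonneg (mul_nonneg (mul_nonneg (by positivity) (Nat.cast_nonneg _)) (by positivity)) (pow_nonneg hκ _))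
      (mul_nonneg (pow_nonneg hρc _) (mul_nonneg hε (hB0 _ _)))
  · have hlt : q + 1 < m' := (mem_Ioc.1 hm').1
    have hf := inv_factorial_mul_pow_le_choose (p := q + 1) (m' := m') (by omega)
    rw [show q + 1 + 1 = q + 2 by ring] at hf
    have hJ := prod_sub_mul_pow_le_pow (q + 1) m' J
    have hκp : κ ^ (2 * m' - 2 * (q + 1)) = (κ ^ 2) ^ (m' - (q + 1)) := by
      rw [← pow_mul, show 2 * (m' - (q + 1)) = 2 * m' - 2 * (q + 1) by omega]
    rw [hκp]
    have hσ : 0 ≤ (κ ^ 2) ^ (m' - (q + 1)) := by positivity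
    have hfi : 0 ≤ ((((2 * (q + 1)) ! : ℝ))⁻¹) := by positivity
    calc (((2 * (q + 1)) ! : ℝ))⁻¹ * ((∏ j ∈ univ.filter (fun j : Fin (2 * (q + 1)) => j ∉ J), (2 * m' - (j : ℕ)) : ℕ) : ℝ) *
          ((2 * m' : ℕ) : ℝ) ^ J.card * (κ ^ 2) ^ (m' - (q + 1)) * (ρc ^ J.card * (ε * B m' J.card))
        = (((2 * (q + 1)) ! : ℝ))⁻¹ * (((∏ j ∈ univ.filter (fun j : Fin (2 * (q + 1)) => j ∉ J), (2 * m' - (j : ℕ)) : ℕ) : ℝ) *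
          ((2 * m' : ℕ) : ℝ) ^ J.card) * (κ ^ 2) ^ (m' - (q + 1)) * (ρc ^ J.card * (ε * B m' J.card)) := by ring
      _ ≤ (((2 * (q + 1)) ! : ℝ))⁻¹ * ((2 * m' : ℕ) : ℝ) ^ (2 * (q + 1)) * (κ ^ 2) ^ (m' - (q + 1)) * N m' := by
          refine mul_le_mul (mul_le_mul_of_nonneg_right (mul_le_mul_of_nonneg_left hJ hfi) hσ) (hNB _)
            (mul_nonneg (pow_nonneg hρc _) (mul_nonneg hε (hB0 _ _))) (by positivity)
      _ ≤ exp 2 ^ (q + 2) / 2 * ((2 * m').choose (2 * (q + 1)) : ℝ) * (κ ^ 2) ^ (m' - (q + 1)) * N m' := by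
          have hN : 0 ≤ N m' := le_trans (mul_nonneg (pow_nonneg hρc _) (mul_nonneg hε (hB0 m' J.card))) (hNB _)
          exact mul_le_mul_of_nonneg_right (mul_le_mul_of_nonneg_right hf hσ) hN
      _ = exp 2 ^ (q + 2) / 2 * (((2 * m').choose (2 * (q + 1)) : ℝ) * (κ ^ 2) ^ (m' - (q + 1)) * N m') := by ring

/-! ## §2 The kit form from any oriented door form -/

section Generic

variable {L M : ℕ} [NeZero L]

/-- **THE ORIENTED KIT FORM FROM ANY DOOR FORM, EVERY PRESCRIPTION.**  Data: `0 ≤ β`, an output element `T′` read at `F_{J′}`, an input family index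
`n₁ ≤ J′` (parents count `27`), `κ, ρ > 0`, line constants `0 ≤ α ≤ α_g`, `cr, cc ≥ 0`, `N₀ ≥ 2`; a full-pin array `B ≥ 0` (flat tail and first order),
graded sizes `Bm ≥ 0`, `Bm 0 = 0`, floor ratio `0 ≤ θ ≤ 1`; a prescription `Ωe` of degree `2(q+1)` and level `F`; majorants `Nt` (tail: `ε·B m 0 ≤ Nt m`,
`Nt 0 = 0`) and `NF` (first order: `27^c·ε·B m c ≤ NF m` for `c + 1 ≥ F`); `D ≥ |Γ|/2`; `τ ≥ (e³κ)², (e²(κ+ρ))²`; `ψ ≥ κ⁻², ρ⁻²`; kit guard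
`e·α_g/κ²·towerV D τ Nt < 1`.  If the ORIENTED DOOR FORM holds at every `(p, J ∌ p, τ″, w″)` — the door-form sum of `‖kernel (map E(F_{J′})) T′ (2q+2) ·‖`
bounded by `cr·cc^{2q+1}·((∏_{j∈J} parents_j)·(graded(α_g, Bm, θ^{lumps (1+|J|)}) + tail(α, B))) + cr·cc^{2q+1}·binomialJ(B)` — then
`klLevNormOf … J′ (2(q+1)) T′ Ωe ≤ ε^{2q+1}·(cr·cc^{2q+1}·(27^F·(θ^{lumps F}·S + T)) + cr·cc^{2q+1}·((e²)^{q+2}/2·towerFO D κ² NF (q+1)))`. -/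
theorem klLevNormOf_le_kit_oriented_of_doorForm [NeZero M] {β : ℝ} (hβ : 0 ≤ β) (μ : ℝ) (K : TrigPolyC4v) {J' n₁ : ℕ} (hnJ : n₁ ≤ J')
    (T' : HubbardGrassmann L M) {κ : ℝ} (hκ : 0 < κ) {ρ : ℝ} (hρ : 0 < ρ) {α αg : ℝ} (hα : 0 ≤ α) (hαg : α ≤ αg)
    {cr cc : ℝ} (hcr0 : 0 ≤ cr) (hcc0 : 0 ≤ cc) {N₀ : ℕ} (hN₀ : 2 ≤ N₀)
    {B : ℕ → ℕ → ℝ} (hB0 : ∀ m c, 0 ≤ B m c) {Bm : ℕ → ℝ} (hBm0 : ∀ m, 0 ≤ Bm m) (hBm00 : Bm 0 = 0)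
    {θ : ℝ} (hθ0 : 0 ≤ θ) (hθ1 : θ ≤ 1)
    {q : ℕ} (Ωe : Fin (2 * q + 1 + 1) → Option (SectorLeg (sectorCount J')))
    {Nt : ℕ → ℝ} (hNt0 : ∀ m, 0 ≤ Nt m) (hNt00 : Nt 0 = 0) (hNtB : ∀ m, imagTimeWeight β M * B m 0 ≤ Nt m)
    {NF : ℕ → ℝ} (hNF : ∀ m c, levelCount Ωe ≤ c + 1 → (27 : ℝ) ^ c * (imagTimeWeight β M * B m c) ≤ NF m)
    {D : ℕ} (hD : Fintype.card (SpaceTimeIdx L M × SectorLeg (sectorCount n₁)) / 2 ≤ D)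
    {τ ψ : ℝ} (hτ1 : (exp 3 * κ) ^ 2 ≤ τ) (hτ2 : (exp 2 * (κ + ρ)) ^ 2 ≤ τ) (hψ1 : κ⁻¹ ^ 2 ≤ ψ) (hψ2 : ρ⁻¹ ^ 2 ≤ ψ)
    (hguard : exp 1 * αg / κ ^ 2 * towerV D τ Nt < 1)
    (hdoor : ∀ (p : Fin (2 * q + 1 + 1)) (J : Finset (Fin (2 * q + 1 + 1))), p ∉ J →
      ∀ (τ'' : Fin (2 * q + 1 + 1) → SectorLeg (sectorCount J')) (w'' : SpaceTimeIdx L M × SectorLeg (sectorCount J')),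
        ∑ X'' ∈ univ.filter (fun X'' : Fin (2 * q + 1 + 1) → SpaceTimeIdx L M × SectorLeg (sectorCount J') =>
            X'' p = w'' ∧ ∀ j ∈ J, (X'' j).2 = τ'' j),
            ‖kernel ℂ (ExteriorAlgebra.map (Matrix.toLin' (sectorAnalysisMatrix L M β (klAnisoFamily L M β μ K klE0 J'))) T')
              (2 * q + 1 + 1) X''‖ ≤
          cr * cc ^ (2 * q + 1) * ((∏ j ∈ J, (((univ.filter fun ℓ' : SectorLeg (sectorCount n₁) =>
              (∃ q' : FreqMomentum L M, klAnisoFamily L M β μ K klE0 J' (τ'' j).1.1 q' ≠ 0 ∧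
                bgmFatMultiplier L M klE0 β (nambuXiCT L μ K) n₁ ℓ'.1.1 q' ≠ 0) ∧
              ℓ'.1.2 = (τ'' j).1.2 ∧ ℓ'.2 = (τ'' j).2).card : ℕ) : ℝ)) *
            (∑ n ∈ Ico 2 N₀, (κ⁻¹ ^ (2 * q + 1 + 1) * κ⁻¹ ^ (2 * (n - 1)) * (αg ^ (n - 1) * Real.exp n)) *
                ∑ δ ∈ (Fintype.piFinset fun _ : Fin n => range (Fintype.card (SpaceTimeIdx L M × SectorLeg (sectorCount n₁)) / 2 + 1)) with
                    2 * q + 1 + 1 + 2 * (n - 1) ≤ ∑ a, 2 * δ a,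
                  ∑ pf : J → Fin n, ((∏ j, ((2 * δ (pf j) : ℕ) : ℝ)) / ((∑ a, 2 * δ a : ℕ) : ℝ) ^ J.card) *
                    ((Real.exp 3 * κ) ^ (∑ a, 2 * δ a) * ((∏ a, Bm (δ a)) * θ ^ lumps (1 + J.card))) +
              ρ⁻¹ ^ (2 * q + 1 + 1) * (Real.exp 1 * normV (SpaceTimeIdx L M × SectorLeg (sectorCount n₁)) κ ρ
                  (fun m' => imagTimeWeight β M * B m' 0)) *
                (Real.exp 1 * α * normV (SpaceTimeIdx L M × SectorLeg (sectorCount n₁)) κ ρ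
                    (fun m' => imagTimeWeight β M * B m' 0) / κ ^ 2) ^ (N₀ - 1) /
                (1 - Real.exp 1 * α * normV (SpaceTimeIdx L M × SectorLeg (sectorCount n₁)) κ ρ
                    (fun m' => imagTimeWeight β M * B m' 0) / κ ^ 2))) +
          cr * cc ^ (2 * q + 1) *
            ∑ m' ∈ range (Fintype.card (SpaceTimeIdx L M × SectorLeg (sectorCount n₁)) / 2 + 1), (if q + 1 < m' then
              ((((2 * (q + 1)).factorial : ℝ))⁻¹ * ((∏ j ∈ univ.filter (fun j : Fin (2 * (q + 1)) => j ∉ J), (2 * m' - (j : ℕ)) : ℕ) : ℝ)) *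
                ((2 * m' : ℕ) : ℝ) ^ J.card * κ ^ (2 * m' - 2 * (q + 1)) *
                  ((27 : ℝ) ^ J.card * (imagTimeWeight β M * B m' J.card)) else 0)) :
    klLevNormOf L M β μ K J' (2 * q + 1 + 1) T' Ωe ≤
      imagTimeWeight β M ^ (2 * q + 1) *
        (cr * cc ^ (2 * q + 1) * ((27 : ℝ) ^ levelCount Ωe *
            (θ ^ lumps (levelCount Ωe) *
                ∑ n ∈ Icc 2 (N₀ - 1), exp 1 * (exp 1 * αg / κ ^ 2) ^ (n - 1) * ψ ^ (q + 1) * towerS D τ Bm n (q + 1) +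
              ψ ^ (q + 1) * (exp 1 * towerV D τ Nt * (exp 1 * αg / κ ^ 2 * towerV D τ Nt) ^ (N₀ - 1) /
                (1 - exp 1 * αg / κ ^ 2 * towerV D τ Nt)))) +
          cr * cc ^ (2 * q + 1) * (exp 2 ^ (q + 2) / 2 * towerFO D (κ ^ 2) NF (q + 1))) := by
  have hε : 0 ≤ imagTimeWeight β M := imagTimeWeight_nonneg hβ M
  have h27 : (0 : ℝ) ≤ 27 := by norm_num
  -- abbreviations for the kit terms and their signs
  set Φ := exp 1 * αg / κ ^ 2 with hΦ
  set V := towerV D τ Nt with hV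
  set FO := towerFO D (κ ^ 2) NF (q + 1) with hFO
  set S := ∑ n ∈ Icc 2 (N₀ - 1), exp 1 * Φ ^ (n - 1) * ψ ^ (q + 1) * towerS D τ Bm n (q + 1) with hS
  set T := ψ ^ (q + 1) * (exp 1 * V * (Φ * V) ^ (N₀ - 1) / (1 - Φ * V)) with hT
  set F := levelCount Ωe with hFdef
  have hαg0 : 0 ≤ αg := hα.trans hαg
  have hτ0 : 0 ≤ τ := le_trans (by positivity) hτ1
  have hψ0 : 0 ≤ ψ := le_trans (by positivity) hψ1
  have hΦ0 : 0 ≤ Φ := by rw [hΦ]; positivity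
  have hV0 : 0 ≤ V := towerV_nonneg (D := D) hτ0 hNt0
  have hNF0 : ∀ m, 0 ≤ NF m := fun m =>
    le_trans (mul_nonneg (pow_nonneg h27 _) (mul_nonneg hε (hB0 m F))) (hNF m F (by omega))
  have hFO0 : 0 ≤ FO := towerFO_nonneg (by positivity) hNF0 _
  have hS0 : 0 ≤ S := sum_nonneg fun n _ => by
    have := towerS_nonneg (D := D) hτ0 hBm0 n (q + 1); positivity
  have hT0 : 0 ≤ T := mul_nonneg (pow_nonneg hψ0 _) (div_nonneg (by positivity) (sub_nonneg.2 hguard.le))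
  have hcrcc : 0 ≤ cr * cc ^ (2 * q + 1) := by positivity
  have hC0 : 0 ≤ imagTimeWeight β M ^ (2 * q + 1) *
      (cr * cc ^ (2 * q + 1) * ((27 : ℝ) ^ F * (θ ^ lumps F * S + T)) + cr * cc ^ (2 * q + 1) * (exp 2 ^ (q + 2) / 2 * FO)) := by
    positivity
  -- the output bridge: every door-form sum is bounded by the kit right side
  refine klLevNormOf_le_of_forall_doorSum_le hβ μ K J' T' Ωe hC0 fun p s x => ?_
  set J : Finset (Fin (2 * q + 1 + 1)) := univ.filter (fun i : Fin (2 * q + 1 + 1) => (Ωe i).isSome ∧ i ≠ p) with hJdef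
  have hp : p ∉ J := by rw [hJdef, mem_filter]; exact fun h => h.2.2 rfl
  -- `|J_p| ∈ {F − 1, F}`
  have hJF : J.card ≤ F := by
    rw [hFdef, levelCount, hJdef]
    exact card_le_card (monotone_filter_right _ fun i _ hi => hi.1)
  have hFJ : F ≤ 1 + J.card := by
    rw [hFdef, levelCount, hJdef]
    have hsub : (univ.filter fun i : Fin (2 * q + 1 + 1) => (Ωe i).isSome) ⊆
        insert p (univ.filter fun i : Fin (2 * q + 1 + 1) => (Ωe i).isSome ∧ i ≠ p) := by
      intro i hi
      rw [mem_insert, mem_filter]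
      rw [mem_filter] at hi
      by_cases hip : i = p
      · exact Or.inl hip
      · exact Or.inr ⟨mem_univ _, hi.2, hip⟩
    exact (card_le_card hsub).trans ((card_insert_le _ _).trans (by omega))
  -- the door form at this `(p, J, τ″, w″)`
  have hd := hdoor p J hp (fun j => (Ωe j).getD s) (x, s)
  -- (iii) the oriented bracket under the kit step, floor credit `θ^{lumps (1+|J|)}` in front
  have hkit := doorGradedOriented_le_kitStep (Γ := SpaceTimeIdx L M × SectorLeg (sectorCount n₁)) (Jt := ↥J)
    hκ hρ hα hαg hε (θL := θ ^ lumps (1 + J.card)) (pow_nonneg hθ0 _) hBm0 hBm00 (B := B) (fun m => hB0 m 0) hNt0 hNt00 hNtB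
    hD hN₀ (m := 2 * q + 1) (p := q + 1) (by ring) hτ1 hτ2 hψ1 hψ2 hguard
  rw [Fintype.card_coe] at hkit
  -- floor credit and parents product monotonised to the level `F`
  have hθF : θ ^ lumps (1 + J.card) ≤ θ ^ lumps F := pow_le_pow_of_le_one hθ0 hθ1 (lumps_mono hFJ)
  have hGT := hkit.trans (add_le_add (mul_le_mul_of_nonneg_right hθF hS0) (le_refl T))
  have hpar : (∏ j ∈ J, (((univ.filter fun ℓ' : SectorLeg (sectorCount n₁) =>
      (∃ q' : FreqMomentum L M, klAnisoFamily L M β μ K klE0 J' ((Ωe j).getD s).1.1 q' ≠ 0 ∧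
        bgmFatMultiplier L M klE0 β (nambuXiCT L μ K) n₁ ℓ'.1.1 q' ≠ 0) ∧
      ℓ'.1.2 = ((Ωe j).getD s).1.2 ∧ ℓ'.2 = ((Ωe j).getD s).2).card : ℕ) : ℝ)) ≤ (27 : ℝ) ^ F := by
    calc _ ≤ ∏ _j ∈ J, (27 : ℝ) := prod_le_prod (fun j _ => Nat.cast_nonneg _) fun j _ => by
            convert card_parentsLeg_klAniso_le β μ K hnJ ((Ωe j).getD s) using 3
      _ = (27 : ℝ) ^ J.card := prod_const _
      _ ≤ (27 : ℝ) ^ F := pow_le_pow_right₀ (by norm_num) hJF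
  have hP0 : 0 ≤ ∏ j ∈ J, (((univ.filter fun ℓ' : SectorLeg (sectorCount n₁) =>
      (∃ q' : FreqMomentum L M, klAnisoFamily L M β μ K klE0 J' ((Ωe j).getD s).1.1 q' ≠ 0 ∧
        bgmFatMultiplier L M klE0 β (nambuXiCT L μ K) n₁ ℓ'.1.1 q' ≠ 0) ∧
      ℓ'.1.2 = ((Ωe j).getD s).1.2 ∧ ℓ'.2 = ((Ωe j).getD s).2).card : ℕ) : ℝ) := prod_nonneg fun j _ => Nat.cast_nonneg _
  have hPGT := (mul_le_mul_of_nonneg_left hGT hP0).trans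
    (mul_le_mul_of_nonneg_right hpar (add_nonneg (mul_nonneg (pow_nonneg hθ0 _) hS0) hT0))
  -- first order, majorant at the level `|J_p|` only
  have hfo := doorBinomialPrescribedJ_le_towerFO_at (κ := κ) (ρc := (27 : ℝ)) (ε := imagTimeWeight β M) hκ.le h27 hε hB0
    (q := q) J (N := NF) (fun m => hNF m J.card (by omega)) hD
  -- assemble
  have hfin := hd.trans (add_le_add (mul_le_mul_of_nonneg_left hPGT hcrcc) (mul_le_mul_of_nonneg_left hfo hcrcc))
  exact mul_le_mul_of_nonneg_left hfin (pow_nonneg hε _)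

/-- **THE ORIENTED KIT FORM FROM ANY DOOR FORM, FIRST-ORDER MAJORANT ASKED ONLY AT THE TWO LEVELS THAT OCCUR** (`|J_p| ∈ {F−1, F}`):
as `klLevNormOf_le_kit_oriented_of_doorForm`, with `hNF` required only for `F ≤ c + 1 ∧ c ≤ F` (so a consumer may take
`NF m := 27^F·ε·(level-F size)` by antitonicity).  Original docstring:  Data: `0 ≤ β`, an output element `T′` read at `F_{J′}`, an input family index
`n₁ ≤ J′` (parents count `27`), `κ, ρ > 0`, line constants `0 ≤ α ≤ α_g`, `cr, cc ≥ 0`, `N₀ ≥ 2`; a full-pin array `B ≥ 0` (flat tail and first order),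
graded sizes `Bm ≥ 0`, `Bm 0 = 0`, floor ratio `0 ≤ θ ≤ 1`; a prescription `Ωe` of degree `2(q+1)` and level `F`; majorants `Nt` (tail: `ε·B m 0 ≤ Nt m`,
`Nt 0 = 0`) and `NF` (first order: `27^c·ε·B m c ≤ NF m` for `c + 1 ≥ F`); `D ≥ |Γ|/2`; `τ ≥ (e³κ)², (e²(κ+ρ))²`; `ψ ≥ κ⁻², ρ⁻²`; kit guard
`e·α_g/κ²·towerV D τ Nt < 1`.  If the ORIENTED DOOR FORM holds at every `(p, J ∌ p, τ″, w″)` — the door-form sum of `‖kernel (map E(F_{J′})) T′ (2q+2) ·‖`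
bounded by `cr·cc^{2q+1}·((∏_{j∈J} parents_j)·(graded(α_g, Bm, θ^{lumps (1+|J|)}) + tail(α, B))) + cr·cc^{2q+1}·binomialJ(B)` — then
`klLevNormOf … J′ (2(q+1)) T′ Ωe ≤ ε^{2q+1}·(cr·cc^{2q+1}·(27^F·(θ^{lumps F}·S + T)) + cr·cc^{2q+1}·((e²)^{q+2}/2·towerFO D κ² NF (q+1)))`. -/
theorem klLevNormOf_le_kit_oriented_of_doorForm_at [NeZero M] {β : ℝ} (hβ : 0 ≤ β) (μ : ℝ) (K : TrigPolyC4v) {J' n₁ : ℕ} (hnJ : n₁ ≤ J')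
    (T' : HubbardGrassmann L M) {κ : ℝ} (hκ : 0 < κ) {ρ : ℝ} (hρ : 0 < ρ) {α αg : ℝ} (hα : 0 ≤ α) (hαg : α ≤ αg)
    {cr cc : ℝ} (hcr0 : 0 ≤ cr) (hcc0 : 0 ≤ cc) {N₀ : ℕ} (hN₀ : 2 ≤ N₀)
    {B : ℕ → ℕ → ℝ} (hB0 : ∀ m c, 0 ≤ B m c) {Bm : ℕ → ℝ} (hBm0 : ∀ m, 0 ≤ Bm m) (hBm00 : Bm 0 = 0)
    {θ : ℝ} (hθ0 : 0 ≤ θ) (hθ1 : θ ≤ 1)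
    {q : ℕ} (Ωe : Fin (2 * q + 1 + 1) → Option (SectorLeg (sectorCount J')))
    {Nt : ℕ → ℝ} (hNt0 : ∀ m, 0 ≤ Nt m) (hNt00 : Nt 0 = 0) (hNtB : ∀ m, imagTimeWeight β M * B m 0 ≤ Nt m)
    {NF : ℕ → ℝ} (hNF : ∀ m c, levelCount Ωe ≤ c + 1 → c ≤ levelCount Ωe → (27 : ℝ) ^ c * (imagTimeWeight β M * B m c) ≤ NF m)
    {D : ℕ} (hD : Fintype.card (SpaceTimeIdx L M × SectorLeg (sectorCount n₁)) / 2 ≤ D)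
    {τ ψ : ℝ} (hτ1 : (exp 3 * κ) ^ 2 ≤ τ) (hτ2 : (exp 2 * (κ + ρ)) ^ 2 ≤ τ) (hψ1 : κ⁻¹ ^ 2 ≤ ψ) (hψ2 : ρ⁻¹ ^ 2 ≤ ψ)
    (hguard : exp 1 * αg / κ ^ 2 * towerV D τ Nt < 1)
    (hdoor : ∀ (p : Fin (2 * q + 1 + 1)) (J : Finset (Fin (2 * q + 1 + 1))), p ∉ J →
      ∀ (τ'' : Fin (2 * q + 1 + 1) → SectorLeg (sectorCount J')) (w'' : SpaceTimeIdx L M × SectorLeg (sectorCount J')),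
        ∑ X'' ∈ univ.filter (fun X'' : Fin (2 * q + 1 + 1) → SpaceTimeIdx L M × SectorLeg (sectorCount J') =>
            X'' p = w'' ∧ ∀ j ∈ J, (X'' j).2 = τ'' j),
            ‖kernel ℂ (ExteriorAlgebra.map (Matrix.toLin' (sectorAnalysisMatrix L M β (klAnisoFamily L M β μ K klE0 J'))) T')
              (2 * q + 1 + 1) X''‖ ≤
          cr * cc ^ (2 * q + 1) * ((∏ j ∈ J, (((univ.filter fun ℓ' : SectorLeg (sectorCount n₁) =>
              (∃ q' : FreqMomentum L M, klAnisoFamily L M β μ K klE0 J' (τ'' j).1.1 q' ≠ 0 ∧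
                bgmFatMultiplier L M klE0 β (nambuXiCT L μ K) n₁ ℓ'.1.1 q' ≠ 0) ∧
              ℓ'.1.2 = (τ'' j).1.2 ∧ ℓ'.2 = (τ'' j).2).card : ℕ) : ℝ)) *
            (∑ n ∈ Ico 2 N₀, (κ⁻¹ ^ (2 * q + 1 + 1) * κ⁻¹ ^ (2 * (n - 1)) * (αg ^ (n - 1) * Real.exp n)) *
                ∑ δ ∈ (Fintype.piFinset fun _ : Fin n => range (Fintype.card (SpaceTimeIdx L M × SectorLeg (sectorCount n₁)) / 2 + 1)) with
                    2 * q + 1 + 1 + 2 * (n - 1) ≤ ∑ a, 2 * δ a,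
                  ∑ pf : J → Fin n, ((∏ j, ((2 * δ (pf j) : ℕ) : ℝ)) / ((∑ a, 2 * δ a : ℕ) : ℝ) ^ J.card) *
                    ((Real.exp 3 * κ) ^ (∑ a, 2 * δ a) * ((∏ a, Bm (δ a)) * θ ^ lumps (1 + J.card))) +
              ρ⁻¹ ^ (2 * q + 1 + 1) * (Real.exp 1 * normV (SpaceTimeIdx L M × SectorLeg (sectorCount n₁)) κ ρ
                  (fun m' => imagTimeWeight β M * B m' 0)) *
                (Real.exp 1 * α * normV (SpaceTimeIdx L M × SectorLeg (sectorCount n₁)) κ ρ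
                    (fun m' => imagTimeWeight β M * B m' 0) / κ ^ 2) ^ (N₀ - 1) /
                (1 - Real.exp 1 * α * normV (SpaceTimeIdx L M × SectorLeg (sectorCount n₁)) κ ρ
                    (fun m' => imagTimeWeight β M * B m' 0) / κ ^ 2))) +
          cr * cc ^ (2 * q + 1) *
            ∑ m' ∈ range (Fintype.card (SpaceTimeIdx L M × SectorLeg (sectorCount n₁)) / 2 + 1), (if q + 1 < m' then
              ((((2 * (q + 1)).factorial : ℝ))⁻¹ * ((∏ j ∈ univ.filter (fun j : Fin (2 * (q + 1)) => j ∉ J), (2 * m' - (j : ℕ)) : ℕ) : ℝ)) *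
                ((2 * m' : ℕ) : ℝ) ^ J.card * κ ^ (2 * m' - 2 * (q + 1)) *
                  ((27 : ℝ) ^ J.card * (imagTimeWeight β M * B m' J.card)) else 0)) :
    klLevNormOf L M β μ K J' (2 * q + 1 + 1) T' Ωe ≤
      imagTimeWeight β M ^ (2 * q + 1) *
        (cr * cc ^ (2 * q + 1) * ((27 : ℝ) ^ levelCount Ωe *
            (θ ^ lumps (levelCount Ωe) *
                ∑ n ∈ Icc 2 (N₀ - 1), exp 1 * (exp 1 * αg / κ ^ 2) ^ (n - 1) * ψ ^ (q + 1) * towerS D τ Bm n (q + 1) +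
              ψ ^ (q + 1) * (exp 1 * towerV D τ Nt * (exp 1 * αg / κ ^ 2 * towerV D τ Nt) ^ (N₀ - 1) /
                (1 - exp 1 * αg / κ ^ 2 * towerV D τ Nt)))) +
          cr * cc ^ (2 * q + 1) * (exp 2 ^ (q + 2) / 2 * towerFO D (κ ^ 2) NF (q + 1))) := by
  have hε : 0 ≤ imagTimeWeight β M := imagTimeWeight_nonneg hβ M
  have h27 : (0 : ℝ) ≤ 27 := by norm_num
  -- abbreviations for the kit terms and their signs
  set Φ := exp 1 * αg / κ ^ 2 with hΦ
  set V := towerV D τ Nt with hV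
  set FO := towerFO D (κ ^ 2) NF (q + 1) with hFO
  set S := ∑ n ∈ Icc 2 (N₀ - 1), exp 1 * Φ ^ (n - 1) * ψ ^ (q + 1) * towerS D τ Bm n (q + 1) with hS
  set T := ψ ^ (q + 1) * (exp 1 * V * (Φ * V) ^ (N₀ - 1) / (1 - Φ * V)) with hT
  set F := levelCount Ωe with hFdef
  have hαg0 : 0 ≤ αg := hα.trans hαg
  have hτ0 : 0 ≤ τ := le_trans (by positivity) hτ1
  have hψ0 : 0 ≤ ψ := le_trans (by positivity) hψ1
  have hΦ0 : 0 ≤ Φ := by rw [hΦ]; positivity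
  have hV0 : 0 ≤ V := towerV_nonneg (D := D) hτ0 hNt0
  have hNF0 : ∀ m, 0 ≤ NF m := fun m =>
    le_trans (mul_nonneg (pow_nonneg h27 _) (mul_nonneg hε (hB0 m F))) (hNF m F (by omega) le_rfl)
  have hFO0 : 0 ≤ FO := towerFO_nonneg (by positivity) hNF0 _
  have hS0 : 0 ≤ S := sum_nonneg fun n _ => by
    have := towerS_nonneg (D := D) hτ0 hBm0 n (q + 1); positivity
  have hT0 : 0 ≤ T := mul_nonneg (pow_nonneg hψ0 _) (div_nonneg (by positivity) (sub_nonneg.2 hguard.le))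
  have hcrcc : 0 ≤ cr * cc ^ (2 * q + 1) := by positivity
  have hC0 : 0 ≤ imagTimeWeight β M ^ (2 * q + 1) *
      (cr * cc ^ (2 * q + 1) * ((27 : ℝ) ^ F * (θ ^ lumps F * S + T)) + cr * cc ^ (2 * q + 1) * (exp 2 ^ (q + 2) / 2 * FO)) := by
    positivity
  -- the output bridge: every door-form sum is bounded by the kit right side
  refine klLevNormOf_le_of_forall_doorSum_le hβ μ K J' T' Ωe hC0 fun p s x => ?_
  set J : Finset (Fin (2 * q + 1 + 1)) := univ.filter (fun i : Fin (2 * q + 1 + 1) => (Ωe i).isSome ∧ i ≠ p) with hJdef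
  have hp : p ∉ J := by rw [hJdef, mem_filter]; exact fun h => h.2.2 rfl
  -- `|J_p| ∈ {F − 1, F}`
  have hJF : J.card ≤ F := by
    rw [hFdef, levelCount, hJdef]
    exact card_le_card (monotone_filter_right _ fun i _ hi => hi.1)
  have hFJ : F ≤ 1 + J.card := by
    rw [hFdef, levelCount, hJdef]
    have hsub : (univ.filter fun i : Fin (2 * q + 1 + 1) => (Ωe i).isSome) ⊆
        insert p (univ.filter fun i : Fin (2 * q + 1 + 1) => (Ωe i).isSome ∧ i ≠ p) := by
      intro i hi
      rw [mem_insert, mem_filter]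
      rw [mem_filter] at hi
      by_cases hip : i = p
      · exact Or.inl hip
      · exact Or.inr ⟨mem_univ _, hi.2, hip⟩
    exact (card_le_card hsub).trans ((card_insert_le _ _).trans (by omega))
  -- the door form at this `(p, J, τ″, w″)`
  have hd := hdoor p J hp (fun j => (Ωe j).getD s) (x, s)
  -- (iii) the oriented bracket under the kit step, floor credit `θ^{lumps (1+|J|)}` in front
  have hkit := doorGradedOriented_le_kitStep (Γ := SpaceTimeIdx L M × SectorLeg (sectorCount n₁)) (Jt := ↥J)
    hκ hρ hα hαg hε (θL := θ ^ lumps (1 + J.card)) (pow_nonneg hθ0 _) hBm0 hBm00 (B := B) (fun m => hB0 m 0) hNt0 hNt00 hNtB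
    hD hN₀ (m := 2 * q + 1) (p := q + 1) (by ring) hτ1 hτ2 hψ1 hψ2 hguard
  rw [Fintype.card_coe] at hkit
  -- floor credit and parents product monotonised to the level `F`
  have hθF : θ ^ lumps (1 + J.card) ≤ θ ^ lumps F := pow_le_pow_of_le_one hθ0 hθ1 (lumps_mono hFJ)
  have hGT := hkit.trans (add_le_add (mul_le_mul_of_nonneg_right hθF hS0) (le_refl T))
  have hpar : (∏ j ∈ J, (((univ.filter fun ℓ' : SectorLeg (sectorCount n₁) =>
      (∃ q' : FreqMomentum L M, klAnisoFamily L M β μ K klE0 J' ((Ωe j).getD s).1.1 q' ≠ 0 ∧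
        bgmFatMultiplier L M klE0 β (nambuXiCT L μ K) n₁ ℓ'.1.1 q' ≠ 0) ∧
      ℓ'.1.2 = ((Ωe j).getD s).1.2 ∧ ℓ'.2 = ((Ωe j).getD s).2).card : ℕ) : ℝ)) ≤ (27 : ℝ) ^ F := by
    calc _ ≤ ∏ _j ∈ J, (27 : ℝ) := prod_le_prod (fun j _ => Nat.cast_nonneg _) fun j _ => by
            convert card_parentsLeg_klAniso_le β μ K hnJ ((Ωe j).getD s) using 3
      _ = (27 : ℝ) ^ J.card := prod_const _
      _ ≤ (27 : ℝ) ^ F := pow_le_pow_right₀ (by norm_num) hJF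
  have hP0 : 0 ≤ ∏ j ∈ J, (((univ.filter fun ℓ' : SectorLeg (sectorCount n₁) =>
      (∃ q' : FreqMomentum L M, klAnisoFamily L M β μ K klE0 J' ((Ωe j).getD s).1.1 q' ≠ 0 ∧
        bgmFatMultiplier L M klE0 β (nambuXiCT L μ K) n₁ ℓ'.1.1 q' ≠ 0) ∧
      ℓ'.1.2 = ((Ωe j).getD s).1.2 ∧ ℓ'.2 = ((Ωe j).getD s).2).card : ℕ) : ℝ) := prod_nonneg fun j _ => Nat.cast_nonneg _
  have hPGT := (mul_le_mul_of_nonneg_left hGT hP0).trans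
    (mul_le_mul_of_nonneg_right hpar (add_nonneg (mul_nonneg (pow_nonneg hθ0 _) hS0) hT0))
  -- first order, majorant at the level `|J_p|` only
  have hfo := doorBinomialPrescribedJ_le_towerFO_at (κ := κ) (ρc := (27 : ℝ)) (ε := imagTimeWeight β M) hκ.le h27 hε hB0
    (q := q) J (N := NF) (fun m => hNF m J.card (by omega) hJF) hD
  -- assemble
  have hfin := hd.trans (add_le_add (mul_le_mul_of_nonneg_left hPGT hcrcc) (mul_le_mul_of_nonneg_left hfo hcrcc))
  exact mul_le_mul_of_nonneg_left hfin (pow_nonneg hε _)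

end Generic

end Summit.HubbardSuperconductivity.HubbardSuperconductivity.Theorems.EngineV8

end
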